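import Literature.AnabelianGeometry.EtaleTheta.ClassicalThetaZeros
import HarnessLib

/-!
# [EtTh] Prop. 1.4 (i), proof: "the restriction of `Θ̈` to the component labelled `0` is `Ü − Ü⁻¹`" and
# "the portion of the divisor of poles supported in the special fibre is `D₁`" — the numerical shadow, PROVED

S. Mochizuki, *The étale theta function and its Frobenioid-theoretic manifestations*, Publ. RIMS **45**
(2009), Prop. 1.4 and its proof, PRIMS PDF pp. 247–248 [cite: MochizukiEtTh2009, Prop 1.4 (i) p.21]:
"The formula given for `Θ̈(q_X^{a/2} Ü)` in assertion (ii) shows that the portion of the divisor of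
poles supported in the special fiber of `𝔜̈` is equal to `D₁`. This formula also shows that to complete
the proof of assertion (i), it suffices to show that the given description of the zeroes and poles of
`Θ̈` is accurate over the irreducible component of the special fiber of `𝔜̈` labeled `0`. But this follows
immediately from the fact that the restriction of `Θ̈` to this irreducible component is the rational
function `Ü − Ü⁻¹`."

Proof-only companion (no definitions) of `ClassicalTheta.lean` (abc-iut-L2-t1) and
`ClassicalThetaZeros.lean` (abc-iut-L2-t6); sub-DAG `plan/L2/SUBDAG-EtTh-Prop14.md`, rows P14/L04–L05
(seat abc-iut-w5-d125). The formal scheme `𝔜̈`, its special fibre and the divisor `D₁` have no carrier in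
the tree (recorded in `ClassicalTheta.lean` / `EtaleThetaClass.lean`: "Deliberately NOT typed: the
formal-scheme statements of (i)"). What IS typeable — and is proved here — is the NUMERICAL content of the
two printed sentences on `L`-valued points of the generic fibre (`L` complete, nonarchimedean,
`0 < ‖q̈‖ < 1`; the irreducible component labelled `a ∈ ℤ` of the special fibre of `𝔜̈`, minus its nodes,
specialises the circle `‖Ü‖ = ‖q̈‖^{a}` of the rigid-analytic annulus, `q̈ = q_X^{1/2}`):

* `norm_thetaDdot_sub_sub_inv_le` — **"the restriction of `Θ̈` to the component labelled `0` is
  `Ü − Ü⁻¹`"**: for `‖Ü‖ = 1`, `‖Θ̈(Ü) − (Ü − Ü⁻¹)‖ ≤ ‖q̈‖²` (i.e. `Θ̈ ≡ Ü − Ü⁻¹` modulo `q̈²` on the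
  unit circle), from the factorisation `Θ̈(Ü) = Ü (Ü² − 1) H(Ü)` and the domination estimate of
  `ClassicalThetaZeros.lean`; hence `norm_thetaDdot_of_norm_eq_one`: `‖Θ̈(Ü)‖ = ‖Ü − Ü⁻¹‖` and
  `norm_thetaDdot_le_one_of_norm_eq_one`: `‖Θ̈(Ü)‖ ≤ 1` on the unit circle ("accurate over the
  component labeled `0`": no pole there; the zeros `Ü = ±1` are `thetaDdot_eq_zero_iff_of_mem_annulus`);
* `norm_thetaDdot_zpow_mul_of_norm_eq_one` — **"the formula for `Θ̈(q_X^{a/2} Ü)` shows that the portion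
  of the divisor of poles supported in the special fibre is `D₁`"**, numerically: for `‖V̈‖ = 1` and
  `a ∈ ℤ`, `‖Θ̈(q̈^a V̈)‖ = ‖q̈‖^{-a²} · ‖V̈ − V̈⁻¹‖`; so on the circle over the component labelled `a`,
  `‖Θ̈‖ ≤ ‖q̈‖^{-a²}` (`norm_thetaDdot_le_of_norm_eq_one`) with equality exactly where `‖V̈ − V̈⁻¹‖ = 1`
  (`norm_thetaDdot_eq_iff_of_norm_eq_one`) — the Gauss (sup) norm over that component is
  `‖q̈‖^{-a²} = ‖q_X‖^{-a²/2}`, i.e. `Θ̈` has a pole of order exactly `a²/2 · ord(q_X)` along the component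
  labelled `a` (the multiplicity with which that component enters `D₁`, [EtTh] §1 pp. 243–244), and no
  other poles (`summable_thetaDdotTerm`: the series converges at every `L`-point `Ü ≠ 0`).

Elementary ultrametric analysis; Prop. 1.4 is classical and undisputed. HONEST FRAMING: nothing here bears
on the disputed parts of the IUT corpus; typed ≠ the formal-scheme statement, which stays untyped.
-/

namespace Literature.AnabelianGeometry.EtaleTheta

open Filter Finset
open scoped _root_.Topology

variable {𝕜 : Type*} [NormedField 𝕜] [IsUltrametricDist 𝕜] [CompleteSpace 𝕜]

omit [CompleteSpace 𝕜] in
/-- Ultrametric inequality for differences. [folklore] -/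
private theorem norm_sub_le_max' (x y : 𝕜) : ‖x - y‖ ≤ max ‖x‖ ‖y‖ := by
  simpa [sub_eq_add_neg, norm_neg] using IsUltrametricDist.norm_add_le_max x (-y)

/-! ### The component labelled `0`: `Θ̈ ≡ Ü − Ü⁻¹` on the unit circle -/

/-- On the annulus `‖q̈‖ < ‖Ü‖ ≤ 1` the auxiliary series is its dominant term up to `q̈²`:
`‖H(Ü) − Ü⁻²‖ ≤ ‖q̈‖² ‖Ü‖⁻⁴` (all other terms are that small, `norm_thetaDdotAuxTerm_le_of_ne_neg_one`,
and the absolute value is ultrametric). [cite: MochizukiEtTh2009, Prop 1.4 (i) p.21] -/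
theorem norm_thetaDdotAux_sub_le {q2 U : 𝕜} (hq : ‖q2‖ < 1) (hqU : ‖q2‖ < ‖U‖) (hU1 : ‖U‖ ≤ 1) :
    ‖thetaDdotAux q2 U - (U ^ 2)⁻¹‖ ≤ ‖q2‖ ^ 2 * ((‖U‖ ^ 2)⁻¹) ^ 2 := by
  classical
  have hU : U ≠ 0 := norm_pos_iff.mp ((norm_nonneg q2).trans_lt hqU)
  have hsum := summable_thetaDdotAuxTerm hq hU hU1
  have hC0 : 0 ≤ ‖q2‖ ^ 2 * ((‖U‖ ^ 2)⁻¹) ^ 2 := by positivity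
  have hsplit : thetaDdotAux q2 U - (U ^ 2)⁻¹ = ∑' n : ℤ, ite (n = -1) 0 (thetaDdotAuxTerm q2 U n) := by
    rw [thetaDdotAux, hsum.tsum_eq_add_tsum_ite (-1), thetaDdotAuxTerm_neg_one, add_sub_cancel_left]
  rw [hsplit]
  refine IsUltrametricDist.norm_tsum_le_of_forall_le_of_nonneg hC0 fun n => ?_
  split_ifs with hn
  · rw [norm_zero]
    exact hC0
  · exact norm_thetaDdotAuxTerm_le_of_ne_neg_one hqU hU1 hn

/-- **"The restriction of `Θ̈` to the irreducible component labelled `0` is the rational function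
`Ü − Ü⁻¹`"** (proof of Prop. 1.4, p. 22), numerically: for `‖q̈‖ < 1` and `‖Ü‖ = 1`,
`‖Θ̈(Ü) − (Ü − Ü⁻¹)‖ ≤ ‖q̈‖²` — `Θ̈ ≡ Ü − Ü⁻¹` modulo `q̈²` on the unit circle.
[cite: MochizukiEtTh2009, Prop 1.4 (i) p.22] -/
theorem norm_thetaDdot_sub_sub_inv_le {q2 U : 𝕜} (hq : ‖q2‖ < 1) (hU1 : ‖U‖ = 1) :
    ‖thetaDdot q2 U - (U - U⁻¹)‖ ≤ ‖q2‖ ^ 2 := by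
  have hqU : ‖q2‖ < ‖U‖ := by rw [hU1]; exact hq
  have hU : U ≠ 0 := norm_pos_iff.mp ((norm_nonneg q2).trans_lt hqU)
  have hfac : thetaDdot q2 U - (U - U⁻¹) = U * (U ^ 2 - 1) * (thetaDdotAux q2 U - (U ^ 2)⁻¹) := by
    rw [thetaDdot_eq_mul_thetaDdotAux hq hU]
    field_simp
  have h1 : ‖U * (U ^ 2 - 1)‖ ≤ 1 := by
    rw [norm_mul, hU1, one_mul]
    refine (norm_sub_le_max' _ _).trans (max_le ?_ ?_)
    · rw [norm_pow, hU1, one_pow]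
    · rw [norm_one]
  calc ‖thetaDdot q2 U - (U - U⁻¹)‖
      = ‖U * (U ^ 2 - 1)‖ * ‖thetaDdotAux q2 U - (U ^ 2)⁻¹‖ := by rw [hfac, norm_mul]
    _ ≤ 1 * (‖q2‖ ^ 2 * ((‖U‖ ^ 2)⁻¹) ^ 2) :=
        mul_le_mul h1 (norm_thetaDdotAux_sub_le hq hqU hU1.le) (norm_nonneg _) zero_le_one
    _ = ‖q2‖ ^ 2 := by rw [hU1]; simp

/-- On the annulus `‖q̈‖ < ‖Ü‖ ≤ 1`: `‖Θ̈(Ü)‖ = ‖Ü² − 1‖ / ‖Ü‖` (from `Θ̈ = Ü (Ü² − 1) H` and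
`‖H(Ü)‖ = ‖Ü‖⁻²`). [cite: MochizukiEtTh2009, Prop 1.4 (i) p.22] -/
theorem norm_thetaDdot_of_mem_annulus {q2 U : 𝕜} (hq : ‖q2‖ < 1) (hqU : ‖q2‖ < ‖U‖) (hU1 : ‖U‖ ≤ 1) :
    ‖thetaDdot q2 U‖ = ‖U ^ 2 - 1‖ / ‖U‖ := by
  have hUpos : 0 < ‖U‖ := (norm_nonneg q2).trans_lt hqU
  have hU : U ≠ 0 := norm_pos_iff.mp hUpos
  rw [thetaDdot_eq_mul_thetaDdotAux hq hU, norm_mul, norm_mul, norm_thetaDdotAux_eq hq hqU hU1]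
  field_simp

/-- **On the component labelled `0`** (the unit circle `‖Ü‖ = 1`): `‖Θ̈(Ü)‖ = ‖Ü − Ü⁻¹‖` — the absolute
values of `Θ̈` and of its special-fibre restriction `Ü − Ü⁻¹` agree at every point.
[cite: MochizukiEtTh2009, Prop 1.4 (i) p.22] -/
theorem norm_thetaDdot_of_norm_eq_one {q2 U : 𝕜} (hq : ‖q2‖ < 1) (hU1 : ‖U‖ = 1) :
    ‖thetaDdot q2 U‖ = ‖U - U⁻¹‖ := by
  have hqU : ‖q2‖ < ‖U‖ := by rw [hU1]; exact hq
  have hU : U ≠ 0 := norm_pos_iff.mp ((norm_nonneg q2).trans_lt hqU)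
  have h : U - U⁻¹ = (U ^ 2 - 1) / U := by field_simp
  rw [norm_thetaDdot_of_mem_annulus hq hqU hU1.le, h, norm_div]

/-- On the unit circle `Θ̈` is bounded by `1`: no pole along the component labelled `0` ("the given
description of the … poles … is accurate over the irreducible component … labeled `0`").
[cite: MochizukiEtTh2009, Prop 1.4 (i) p.22] -/
theorem norm_thetaDdot_le_one_of_norm_eq_one {q2 U : 𝕜} (hq : ‖q2‖ < 1) (hU1 : ‖U‖ = 1) :
    ‖thetaDdot q2 U‖ ≤ 1 := by
  have hU : U ≠ 0 := norm_pos_iff.mp (by rw [hU1]; exact one_pos)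
  rw [norm_thetaDdot_of_norm_eq_one hq hU1]
  refine (norm_sub_le_max' _ _).trans (max_le (le_of_eq hU1) ?_)
  rw [norm_inv, hU1, inv_one]

/-! ### The component labelled `a`: pole of order exactly `a²` in `q̈` (the special-fibre part of `D₁`) -/

/-- **"The formula given for `Θ̈(q_X^{a/2} Ü)` in assertion (ii) shows that the portion of the divisor of
poles supported in the special fiber of `𝔜̈` is equal to `D₁`"** (proof of Prop. 1.4, p. 22), numerically:
for `q̈ ≠ 0`, `‖q̈‖ < 1`, `‖V̈‖ = 1` and `a ∈ ℤ`, `‖Θ̈(q̈^a V̈)‖ = ‖q̈‖^{-a²} · ‖V̈ − V̈⁻¹‖`.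
[cite: MochizukiEtTh2009, Prop 1.4 (i) p.22] -/
theorem norm_thetaDdot_zpow_mul_of_norm_eq_one {q2 V : 𝕜} (hq0 : q2 ≠ 0) (hq : ‖q2‖ < 1)
    (hV1 : ‖V‖ = 1) (a : ℤ) :
    ‖thetaDdot q2 (q2 ^ a * V)‖ = ‖q2‖ ^ (-(a * a)) * ‖V - V⁻¹‖ := by
  have hV : V ≠ 0 := norm_pos_iff.mp (by rw [hV1]; exact one_pos)
  rw [thetaDdot_zpow_mul hq0 hV a, norm_mul, norm_mul, norm_mul, Int.cast_negOnePow, norm_zpow,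
    norm_neg, norm_one, one_zpow, one_mul, norm_zpow, norm_zpow, hV1, one_zpow, mul_one,
    norm_thetaDdot_of_norm_eq_one hq hV1]

/-- Upper bound on the circle over the component labelled `a`: `‖Θ̈(q̈^a V̈)‖ ≤ ‖q̈‖^{-a²}` for `‖V̈‖ = 1`
— the pole along that component has order at most `a²` in `q̈` (`= a²/2 · ord(q_X)`).
[cite: MochizukiEtTh2009, Prop 1.4 (i) p.22] -/
theorem norm_thetaDdot_le_of_norm_eq_one {q2 V : 𝕜} (hq0 : q2 ≠ 0) (hq : ‖q2‖ < 1) (hV1 : ‖V‖ = 1)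
    (a : ℤ) : ‖thetaDdot q2 (q2 ^ a * V)‖ ≤ ‖q2‖ ^ (-(a * a)) := by
  rw [norm_thetaDdot_zpow_mul_of_norm_eq_one hq0 hq hV1 a]
  refine mul_le_of_le_one_right (zpow_nonneg (norm_nonneg _) _) ?_
  refine (norm_sub_le_max' _ _).trans (max_le (le_of_eq hV1) ?_)
  rw [norm_inv, hV1, inv_one]

/-- The bound `‖q̈‖^{-a²}` over the component labelled `a` is ATTAINED exactly at the points `q̈^a V̈` with
`‖V̈ − V̈⁻¹‖ = 1` (i.e. `V̈` not congruent to `±1`): the pole along the component labelled `a` has order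
EXACTLY `a²` in `q̈` — the multiplicity `a²/2 · ord(q_X)` of that component in `D₁`.
[cite: MochizukiEtTh2009, Prop 1.4 (i) p.22] -/
theorem norm_thetaDdot_eq_iff_of_norm_eq_one {q2 V : 𝕜} (hq0 : q2 ≠ 0) (hq : ‖q2‖ < 1)
    (hV1 : ‖V‖ = 1) (a : ℤ) :
    ‖thetaDdot q2 (q2 ^ a * V)‖ = ‖q2‖ ^ (-(a * a)) ↔ ‖V - V⁻¹‖ = 1 := by
  rw [norm_thetaDdot_zpow_mul_of_norm_eq_one hq0 hq hV1 a]
  have hpos : 0 < ‖q2‖ ^ (-(a * a)) := zpow_pos (norm_pos_iff.mpr hq0) _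
  constructor
  · intro h
    have := mul_right_injective₀ hpos.ne' (h.trans (mul_one _).symm)
    exact this
  · intro h
    rw [h, mul_one]

end Literature.AnabelianGeometry.EtaleTheta
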